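import Literature.Topology.FourManifolds.RegularLevelParamChart
import Literature.Topology.FourManifolds.TrisectionsMiddleCharts
import Literature.Topology.FourManifolds.HCobordismTradeStep
import Literature.Topology.FourManifolds.SPC4HandleChainProofs
import HarnessLib

/-!
# A transversal closed hypersurface as a section of the gradient-like flow: the section flow rule

Topic `Literature/Topology/FourManifolds`; tool (T2) of step G of a Morse-theoretic construction
of Gay–Kirby's trisection for the fact seat
`provefact-Literature.Topology.FourManifolds.exists_isBalancedGKTrisection` (Gay–Kirby 2016,
Thm. 4 via §4, Lemma 14).  Everything in this file is **proved**; the definitions (the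
projection onto the hypersurface, the parametrisations) are explicit.

Let `B` be a bi-collar on `X` whose unit field `U.ξ` is gradient-like for the Morse function
`f` (`BiCollar.MorseFrame`), `Y = f⁻¹(a)`, and let `N = γ⁻¹(0)` be the regular zero set of a
smooth function `γ` **transversal to the flow**, `U.ξ(γ) > 0` on `N` (for the top face of the
second sector: `γ = s - T`, `TrisectionsTopFaceLevel.lean`).  The flow of `U.ξ` defines the
projection `π_N` onto `N` of the points whose trajectory meets `N` (`BiCollar.projN`, Milnor's
`π(q) = ψ(-τ(q), q)`, smooth: `FlowHittingTime.lean`), and `N` is parametrised near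
`π_N(y₀)` by `Y` near `y₀`: `u ↦ π_N(χ⁻¹ u)` with `χ` a chart of `Y` at `y₀`, with left inverse
`z ↦ χ(λ̂ z)` (`λ̂` the landing map of the bi-collar lifted to `Y`) — parametrisation data in
the sense of `RegularLevelParamChart.lean` (`BiCollar.sectionParam`).  Consequently, for a
function `Φ` on `N` which near `π_N(y₀)` is the transported Heegaard function,
`Φ = g ∘ λ̂ ∘ incl`, **`Φ` is critical at `π_N(y₀)` iff `g` is critical at `y₀`, with the same
nondegeneracy and the same Morse index** (`BiCollar.morseData_section`): the section flow rule.

## References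

* J. Milnor, *Lectures on the h-cobordism theorem* (1965), Thm. 3.4, Thm. 4.1, proof of Thm. 5.4 (Assertion 4). [MilnorHCobordism1965]
* J. Milnor, *Morse theory* (1963), §2. [Milnor1963]
* D. Gay, R. Kirby, *Trisecting 4-manifolds*, Geom. Topol. 20 (2016), §4, Lemma 14. [GayKirby2016]
-/

open scoped Manifold ContDiff Topology
open Set Function Filter

noncomputable section

universe u

namespace Literature.Topology.FourManifolds

open Flow

/-- Local notation: `𝔼 n` is the model Euclidean space `EuclideanSpace ℝ (Fin n)`. -/
local notation "𝔼 " n:arg => EuclideanSpace ℝ (Fin n)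

variable {X : Type u} [TopologicalSpace X] [T2Space X] [CompactSpace X] [ChartedSpace (𝔼 4) X]
  [IsManifold (𝓡 4) ∞ X]

namespace BiCollar

variable (B : BiCollar X) {γ : X → ℝ}

/-- The flow of the unit field as a map `ℝ × X → X`. [cite: LeeSmoothManifolds2013, Thm. 9.12] -/
abbrev θU : ℝ × X → X := flowθ B.U.contMDiff

/-- The flow of the unit field is a smooth flow. [cite: LeeSmoothManifolds2013, Thm. 9.12] -/
theorem isSmoothFlow_θU : IsSmoothFlow (𝓡 4) B.U.ξ B.θU := isSmoothFlow_flow B.U.contMDiff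

/-- `θU (t, x) = U.fl x t`. [folklore] -/
theorem θU_apply (t : ℝ) (x : X) : B.θU (t, x) = B.U.fl x t := rfl

/-- **The trajectory of `x` meets the hypersurface `γ = 0`.** [cite: MilnorHCobordism1965, Thm. 4.1] -/
def HitN (γ : X → ℝ) (x : X) : Prop := Hits B.θU γ 0 x

/-- **The projection along trajectories onto the hypersurface `γ = 0`.** [cite: MilnorHCobordism1965, Thm. 4.1; proof of Thm. 5.4, Assertion 4] -/
def projN (γ : X → ℝ) (x : X) : X := B.θU (hittingTime B.θU γ 0 x, x)

/-- The projection lands on the hypersurface. [cite: MilnorHCobordism1965, Thm. 4.1] -/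
theorem apply_projN {x : X} (hx : B.HitN γ x) : γ (B.projN γ x) = 0 := apply_hittingTime hx

/-- `projN x = U.fl x τ(x)`. [folklore] -/
theorem projN_eq_fl (x : X) : B.projN γ x = B.U.fl x (hittingTime B.θU γ 0 x) := rfl

section Transversal

/-- On the hypersurface the projection is the identity. [cite: MilnorHCobordism1965, Thm. 4.1] -/
theorem projN_of_apply_eq (hγs : ContMDiff (𝓡 4) 𝓘(ℝ, ℝ) ∞ γ) (htr : ∀ x, γ x = 0 → 0 < mlineDeriv (𝓡 4) γ x (B.U.ξ x)) {x : X} (hx : γ x = 0) : B.projN γ x = x := by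
  rw [projN, B.isSmoothFlow_θU.hittingTime_eq_zero (hγs.mdifferentiable (by simp)) htr hx]
  exact B.isSmoothFlow_θU.map_zero x

/-- The projection is constant along trajectories. [cite: MilnorHCobordism1965, Thm. 4.1] -/
theorem projN_fl (hγs : ContMDiff (𝓡 4) 𝓘(ℝ, ℝ) ∞ γ) (htr : ∀ x, γ x = 0 → 0 < mlineDeriv (𝓡 4) γ x (B.U.ξ x)) {x : X} (hx : B.HitN γ x) (t : ℝ) : B.projN γ (B.U.fl x t) = B.projN γ x :=
  B.isSmoothFlow_θU.proj_apply (hγs.mdifferentiable (by simp)) htr hx t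

/-- Hitting is a property of trajectories. [folklore] -/
theorem hitN_fl_iff {x : X} (t : ℝ) : B.HitN γ (B.U.fl x t) ↔ B.HitN γ x :=
  B.isSmoothFlow_θU.hits_apply_iff

/-- The set of points hitting the hypersurface is open. [cite: MilnorHCobordism1965, proof of Thm. 5.4, Assertion 4] -/
theorem isOpen_setOf_hitN (hγs : ContMDiff (𝓡 4) 𝓘(ℝ, ℝ) ∞ γ) (htr : ∀ x, γ x = 0 → 0 < mlineDeriv (𝓡 4) γ x (B.U.ξ x)) : IsOpen {x : X | B.HitN γ x} := by
  rw [isOpen_iff_mem_nhds]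
  intro x hx
  exact B.isSmoothFlow_θU.hits_mem_nhds hγs htr hx (isInteriorPoint_euclidean x)

/-- **The projection is smooth at the points hitting the hypersurface.** [cite: MilnorHCobordism1965, Thm. 4.1; proof of Thm. 5.4, Assertion 4] -/
theorem contMDiffAt_projN (hγs : ContMDiff (𝓡 4) 𝓘(ℝ, ℝ) ∞ γ) (htr : ∀ x, γ x = 0 → 0 < mlineDeriv (𝓡 4) γ x (B.U.ξ x)) {x : X} (hx : B.HitN γ x) : ContMDiffAt (𝓡 4) (𝓡 4) ∞ (B.projN γ) x :=
  B.isSmoothFlow_θU.contMDiffAt_proj hγs htr hx (isInteriorPoint_euclidean x)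

/-- The landing map is unchanged by the projection. [cite: MilnorHCobordism1965, Thm. 4.1] -/
theorem lam_projN (Fr : B.MorseFrame) {x : X} (hx : B.Hit x) : B.lam (B.projN γ x) = B.lam x := by
  rw [projN_eq_fl]; exact Fr.lam_fl hx _

/-- The projection of a hitting point hits the level. [folklore] -/
theorem hit_projN {x : X} (hx : B.Hit x) : B.Hit (B.projN γ x) := by
  rw [projN_eq_fl]; exact B.hit_fl hx _

/-- The lifted landing map is unchanged by the projection. [cite: MilnorHCobordism1965, Thm. 4.1] -/
theorem lamLift_projN (Fr : B.MorseFrame) {x : X} (hx : B.Hit x) : B.lamLift (B.projN γ x) = B.lamLift x := by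
  apply (RegularLevel.isEmbedding_incl B.hf).injective
  rw [B.incl_lamLift (B.hit_projN hx), B.incl_lamLift hx, B.lam_projN Fr hx]

/-- A point of the level is its own landing point. [folklore] -/
theorem lamLift_coe (Fr : B.MorseFrame) (y : B.Y) : B.lamLift y.1 = y := by
  apply (RegularLevel.isEmbedding_incl B.hf).injective
  rw [B.incl_lamLift (B.hit_of_apply_eq y.2), Fr.lam_of_apply_eq y.2]

/-- Points of the level hit the level. [folklore] -/
theorem hit_coe (y : B.Y) : B.Hit y.1 := B.hit_of_apply_eq y.2

/-! ### The section parametrisation of the hypersurface -/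

/-- **Parametrisation data of `N = γ⁻¹(0)` at `π_N(y₀)` by the chart of `Y` at `y₀`.**
[cite: MilnorHCobordism1965, Thm. 4.1] [cite: HirschDT1976, Ch. 1 §3, Thm. 3.2] -/
def sectionParam (hγs : ContMDiff (𝓡 4) 𝓘(ℝ, ℝ) ∞ γ) (htr : ∀ x, γ x = 0 → 0 < mlineDeriv (𝓡 4) γ x (B.U.ξ x)) (Fr : B.MorseFrame) (hγ : IsRegularLevel (𝓡 4) γ 0) (y₀ : B.Y) : hγ.Param where
  O := (chartAt (𝔼 3) y₀).target ∩ (chartAt (𝔼 3) y₀).symm ⁻¹' {y : B.Y | B.HitN γ y.1}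
  isOpen_O := (chartAt (𝔼 3) y₀).continuousOn_symm.isOpen_inter_preimage (chartAt (𝔼 3) y₀).open_target
    ((B.isOpen_setOf_hitN hγs htr).preimage continuous_subtype_val)
  ψ u := B.projN γ ((chartAt (𝔼 3) y₀).symm u).1
  contMDiffOn_ψ := by
    intro u hu
    have h1 : ContMDiffAt (𝓡 3) (𝓡 3) ∞ (chartAt (𝔼 3) y₀).symm u :=
      (contMDiffOn_chart_symm (I := 𝓡 3) (x := y₀)).contMDiffAt ((chartAt (𝔼 3) y₀).open_target.mem_nhds hu.1)
    have h2 : ContMDiffAt (𝓡 3) (𝓡 4) ∞ (fun u => ((chartAt (𝔼 3) y₀).symm u).1) u :=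
      (RegularLevel.contMDiff_incl B.hf).contMDiffAt.comp u h1
    exact ((B.contMDiffAt_projN hγs htr hu.2).comp u h2).contMDiffWithinAt
  apply_ψ u hu := B.apply_projN hu.2
  V := {z : X | B.Hit z ∧ B.HitN γ z ∧ B.lamLift z ∈ (chartAt (𝔼 3) y₀).source}
  isOpen_V := by
    have h1 : IsOpen {z : X | B.Hit z ∧ B.HitN γ z} := (Fr.isOpen_setOf_hit).inter (B.isOpen_setOf_hitN hγs htr)
    have h2 : ContinuousOn B.lamLift {z : X | B.Hit z ∧ B.HitN γ z} := fun z hz =>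
      (Fr.contMDiffAt_lamLift hz.1).continuousAt.continuousWithinAt
    have := h2.isOpen_inter_preimage h1 (chartAt (𝔼 3) y₀).open_source
    convert this using 1
    ext z; simp only [mem_setOf_eq, mem_inter_iff, mem_preimage, and_assoc]
  ψ_mem u hu := by
    refine ⟨B.hit_projN (B.hit_coe _), ?_, ?_⟩
    · exact hits_of_apply_eq (B.isSmoothFlow_θU.map_zero _) (B.apply_projN hu.2)
    · rw [B.lamLift_projN Fr (B.hit_coe _), B.lamLift_coe Fr]
      exact (chartAt (𝔼 3) y₀).map_target hu.1
  lam z := chartAt (𝔼 3) y₀ (B.lamLift z)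
  contMDiffOn_lam := by
    intro z hz
    exact ((contMDiffOn_chart (I := 𝓡 3) (x := y₀)).contMDiffAt ((chartAt (𝔼 3) y₀).open_source.mem_nhds hz.2.2)
      |>.comp z (Fr.contMDiffAt_lamLift hz.1)).contMDiffWithinAt
  lam_ψ u hu := by
    show chartAt (𝔼 3) y₀ (B.lamLift (B.projN γ ((chartAt (𝔼 3) y₀).symm u).1)) = u
    rw [B.lamLift_projN Fr (B.hit_coe _), B.lamLift_coe Fr]
    exact (chartAt (𝔼 3) y₀).right_inv hu.1
  ψ_lam z hz hz0 := by
    obtain ⟨hzh, hzN, hzs⟩ := hz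
    have hback : (chartAt (𝔼 3) y₀).symm (chartAt (𝔼 3) y₀ (B.lamLift z)) = B.lamLift z :=
      (chartAt (𝔼 3) y₀).left_inv hzs
    -- `(lamLift z).1 = lam z = U.fl z t₀` lies on the trajectory of `z`
    obtain ⟨t₀, ht₀⟩ : ∃ t₀, B.lam z = B.U.fl z t₀ := ⟨_, rfl⟩
    have hcoe : (B.lamLift z).1 = B.U.fl z t₀ := by rw [← ht₀]; exact B.incl_lamLift hzh
    refine ⟨⟨(chartAt (𝔼 3) y₀).map_source hzs, ?_⟩, ?_⟩
    · show B.HitN γ ((chartAt (𝔼 3) y₀).symm (chartAt (𝔼 3) y₀ (B.lamLift z))).1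
      rw [hback, hcoe]
      exact (B.hitN_fl_iff t₀).2 hzN
    · show B.projN γ ((chartAt (𝔼 3) y₀).symm (chartAt (𝔼 3) y₀ (B.lamLift z))).1 = z
      rw [hback, hcoe, B.projN_fl hγs htr hzN, B.projN_of_apply_eq hγs htr hz0]

/-- The parameter of `y₀` lies in `O` when `y₀` hits `N`. [folklore] -/
theorem chart_mem_O (hγs : ContMDiff (𝓡 4) 𝓘(ℝ, ℝ) ∞ γ) (htr : ∀ x, γ x = 0 → 0 < mlineDeriv (𝓡 4) γ x (B.U.ξ x)) (Fr : B.MorseFrame) (hγ : IsRegularLevel (𝓡 4) γ 0) {y₀ : B.Y} (hy₀ : B.HitN γ y₀.1) :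
    chartAt (𝔼 3) y₀ y₀ ∈ (B.sectionParam hγs htr Fr hγ y₀).O :=
  ⟨mem_chart_target _ _, by
    show B.HitN γ ((chartAt (𝔼 3) y₀).symm (chartAt (𝔼 3) y₀ y₀)).1
    rw [(chartAt (𝔼 3) y₀).left_inv (mem_chart_source _ _)]; exact hy₀⟩

/-- The lift of the parameter of `y₀` is `π_N(y₀)`. [folklore] -/
theorem incl_lift_chart (hγs : ContMDiff (𝓡 4) 𝓘(ℝ, ℝ) ∞ γ) (htr : ∀ x, γ x = 0 → 0 < mlineDeriv (𝓡 4) γ x (B.U.ξ x)) (Fr : B.MorseFrame) (hγ : IsRegularLevel (𝓡 4) γ 0) {y₀ : B.Y} (hy₀ : B.HitN γ y₀.1) [Nonempty (RegularLevel hγ)] :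
    RegularLevel.incl hγ ((B.sectionParam hγs htr Fr hγ y₀).lift (chartAt (𝔼 3) y₀ y₀)) = B.projN γ y₀.1 := by
  rw [(B.sectionParam hγs htr Fr hγ y₀).incl_lift (B.chart_mem_O hγs htr Fr hγ hy₀)]
  show B.projN γ ((chartAt (𝔼 3) y₀).symm (chartAt (𝔼 3) y₀ y₀)).1 = _
  rw [(chartAt (𝔼 3) y₀).left_inv (mem_chart_source _ _)]

/-! ### The level `Y` parametrised by its own charts -/

/-- **Parametrisation data of `Y` at `y₀` by its chart** (left inverse `χ ∘ yL` on the band). [folklore] -/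
def levelParam (y₀ : B.Y) : B.hf.Param where
  O := (chartAt (𝔼 3) y₀).target
  isOpen_O := (chartAt (𝔼 3) y₀).open_target
  ψ u := ((chartAt (𝔼 3) y₀).symm u).1
  contMDiffOn_ψ := fun u hu =>
    ((RegularLevel.contMDiff_incl B.hf).contMDiffAt.comp u
      ((contMDiffOn_chart_symm (I := 𝓡 3) (x := y₀)).contMDiffAt ((chartAt (𝔼 3) y₀).open_target.mem_nhds hu))).contMDiffWithinAt
  apply_ψ u _ := ((chartAt (𝔼 3) y₀).symm u).2
  V := {z : X | z ∈ B.U.band ∧ B.yL z ∈ (chartAt (𝔼 3) y₀).source}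
  isOpen_V := B.contMDiffOn_yL.continuousOn.isOpen_inter_preimage B.U.isOpen_band (chartAt (𝔼 3) y₀).open_source
  ψ_mem u hu := by
    refine ⟨B.U.mem_band_of_apply_eq ((chartAt (𝔼 3) y₀).symm u).2, ?_⟩
    show B.yL ((chartAt (𝔼 3) y₀).symm u).1 ∈ _
    rw [B.yL_incl]; exact (chartAt (𝔼 3) y₀).map_target hu
  lam z := chartAt (𝔼 3) y₀ (B.yL z)
  contMDiffOn_lam := fun z hz =>
    (((contMDiffOn_chart (I := 𝓡 3) (x := y₀)).contMDiffAt ((chartAt (𝔼 3) y₀).open_source.mem_nhds hz.2)).comp z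
      (B.contMDiffOn_yL.contMDiffAt (B.U.isOpen_band.mem_nhds hz.1))).contMDiffWithinAt
  lam_ψ u hu := by
    show chartAt (𝔼 3) y₀ (B.yL ((chartAt (𝔼 3) y₀).symm u).1) = u
    rw [B.yL_incl]; exact (chartAt (𝔼 3) y₀).right_inv hu
  ψ_lam z hz hz0 := by
    have hyz : B.yL z = ⟨z, hz0⟩ := by
      apply (RegularLevel.isEmbedding_incl B.hf).injective
      rw [B.incl_yL hz.1]; exact B.U.drop_of_apply_eq hz0
    refine ⟨(chartAt (𝔼 3) y₀).map_source hz.2, ?_⟩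
    show ((chartAt (𝔼 3) y₀).symm (chartAt (𝔼 3) y₀ (B.yL z))).1 = z
    rw [(chartAt (𝔼 3) y₀).left_inv hz.2, hyz]

/-- The lift of the level parametrisation is the inverse chart. [folklore] -/
theorem levelParam_lift [Nonempty B.Y] {y₀ : B.Y} {u : 𝔼 3} (hu : u ∈ (chartAt (𝔼 3) y₀).target) :
    (B.levelParam y₀).lift u = (chartAt (𝔼 3) y₀).symm u := by
  apply (RegularLevel.isEmbedding_incl B.hf).injective
  rw [(B.levelParam y₀).incl_lift hu]
  rfl

/-! ### The section flow rule -/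

/-- **The section flow rule.**  Let `Φ : N → ℝ` agree near `π_N(y₀)` with the transported
Heegaard function, `Φ w = g (λ̂ w)`, where `y₀ ∈ Y` hits `N`, and let `g` be `C²`.  Then `Φ` is
critical at `π_N(y₀)` iff `g` is critical at `y₀`; and then the Hessians are simultaneously
nondegenerate and the Morse indices agree. [cite: MilnorHCobordism1965, Thm. 4.1] [cite: Milnor1963, §2] -/
theorem morseData_section (hγs : ContMDiff (𝓡 4) 𝓘(ℝ, ℝ) ∞ γ) (htr : ∀ x, γ x = 0 → 0 < mlineDeriv (𝓡 4) γ x (B.U.ξ x)) (Fr : B.MorseFrame) (hγ : IsRegularLevel (𝓡 4) γ 0) {y₀ : B.Y} (hy₀ : B.HitN γ y₀.1)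
    [Nonempty (RegularLevel hγ)] {Φ : RegularLevel hγ → ℝ}
    (hgs : ContMDiff (𝓡 3) 𝓘(ℝ, ℝ) ∞ B.g)
    (hΦ : ∀ᶠ w in 𝓝 ((B.sectionParam hγs htr Fr hγ y₀).lift (chartAt (𝔼 3) y₀ y₀)), Φ w = B.g (B.lamLift w.1)) :
    (IsMCriticalPt (𝓡 3) Φ ((B.sectionParam hγs htr Fr hγ y₀).lift (chartAt (𝔼 3) y₀ y₀)) ↔ IsMCriticalPt (𝓡 3) B.g y₀) ∧
      (IsMCriticalPt (𝓡 3) B.g y₀ →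
        ((mhessian (𝓡 3) Φ ((B.sectionParam hγs htr Fr hγ y₀).lift (chartAt (𝔼 3) y₀ y₀))).Nondegenerate ↔
            (mhessian (𝓡 3) B.g y₀).Nondegenerate) ∧
          morseIndex (𝓡 3) Φ ((B.sectionParam hγs htr Fr hγ y₀).lift (chartAt (𝔼 3) y₀ y₀)) = morseIndex (𝓡 3) B.g y₀) := by
  haveI : Nonempty B.Y := ⟨y₀⟩
  set P := B.sectionParam hγs htr Fr hγ y₀ with hP
  set Q := B.levelParam y₀ with hQ
  set u₀ := chartAt (𝔼 3) y₀ y₀ with hu₀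
  have hu₀O : u₀ ∈ P.O := B.chart_mem_O hγs htr Fr hγ hy₀
  have hu₀T : u₀ ∈ (chartAt (𝔼 3) y₀).target := mem_chart_target _ _
  have hQlift : Q.lift u₀ = y₀ := by
    rw [hQ, B.levelParam_lift hu₀T, hu₀, (chartAt (𝔼 3) y₀).left_inv (mem_chart_source _ _)]
  -- `Φ ∘ lift_P = g ∘ lift_Q` near `u₀`
  have hlift_cont : ContinuousAt P.lift u₀ := (P.contMDiffAt_lift hu₀O).continuousAt
  have hev : (Φ ∘ P.lift) =ᶠ[𝓝 u₀] fun u => (B.g ∘ Q.lift) u + 0 := by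
    have h1 : ∀ᶠ u in 𝓝 u₀, Φ (P.lift u) = B.g (B.lamLift (P.lift u).1) := hlift_cont.eventually hΦ
    have h2 : ∀ᶠ u in 𝓝 u₀, u ∈ P.O := P.isOpen_O.mem_nhds hu₀O
    filter_upwards [h1, h2] with u hu huO
    simp only [comp_apply, add_zero]
    rw [hu, show (P.lift u).1 = RegularLevel.incl hγ (P.lift u) from rfl, P.incl_lift huO]
    show B.g (B.lamLift (B.projN γ ((chartAt (𝔼 3) y₀).symm u).1)) = B.g (Q.lift u)
    rw [B.lamLift_projN Fr (B.hit_coe _), B.lamLift_coe Fr, hQ,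
      B.levelParam_lift huO.1]
  -- smoothness
  have hgQ : ContMDiffAt (𝓡 3) 𝓘(ℝ, ℝ) 2 (B.g ∘ Q.lift) u₀ :=
    Q.contMDiffAt_comp_lift hu₀T (by norm_cast) (hgs.contMDiffAt.of_le (by norm_cast))
  have hΦP : ContMDiffAt (𝓡 3) 𝓘(ℝ, ℝ) 2 (Φ ∘ P.lift) u₀ :=
    hgQ.congr_of_eventuallyEq (hev.trans (Eventually.of_forall fun u => add_zero _))
  have hΦ2 : ContMDiffAt (𝓡 3) 𝓘(ℝ, ℝ) 2 Φ (P.lift u₀) := by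
    -- `Φ = (Φ ∘ lift) ∘ chart` near the point
    have hch : ContMDiffAt (𝓡 3) (𝓡 3) 2 P.chart (P.lift u₀) :=
      ((contMDiffOn_of_mem_maximalAtlas P.chart_mem_maximalAtlas).contMDiffAt
        (P.chart.open_source.mem_nhds (P.lift_mem_source hu₀O))).of_le (by norm_cast)
    have hcomp : ContMDiffAt (𝓡 3) 𝓘(ℝ, ℝ) 2 ((Φ ∘ P.lift) ∘ P.chart) (P.lift u₀) := by
      refine ContMDiffAt.comp (P.lift u₀) ?_ hch
      rw [P.chart_apply, show (P.lift u₀).1 = RegularLevel.incl hγ (P.lift u₀) from rfl, P.incl_lift hu₀O, P.lam_ψ u₀ hu₀O]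
      exact hΦP
    refine hcomp.congr_of_eventuallyEq ?_
    filter_upwards [P.chart.open_source.mem_nhds (P.lift_mem_source hu₀O)] with w hw
    show Φ w = Φ (P.lift (P.chart w))
    rw [show P.lift (P.chart w) = w from P.chart.left_inv hw]
  have hgd : MDifferentiableAt (𝓡 3) 𝓘(ℝ, ℝ) B.g y₀ := hgs.mdifferentiableAt (by simp)
  -- criticality
  have hcritP : IsMCriticalPt (𝓡 3) Φ (P.lift u₀) ↔ IsMCriticalPt (𝓡 3) (Φ ∘ P.lift) u₀ := by
    rw [P.isMCriticalPt_iff hu₀O (hΦ2.mdifferentiableAt (by norm_cast)), MorseBirth.isMCriticalPt_iff_fderiv]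
  have hcritQ : IsMCriticalPt (𝓡 3) B.g y₀ ↔ IsMCriticalPt (𝓡 3) (B.g ∘ Q.lift) u₀ := by
    rw [← hQlift, Q.isMCriticalPt_iff hu₀T (by rw [hQlift]; exact hgd), MorseBirth.isMCriticalPt_iff_fderiv]
  have hcritPQ : IsMCriticalPt (𝓡 3) (Φ ∘ P.lift) u₀ ↔ IsMCriticalPt (𝓡 3) (B.g ∘ Q.lift) u₀ :=
    isMCriticalPt_congr_of_eventuallyEq_add_const (I := 𝓡 3) hev
  refine ⟨by rw [hcritP, hcritPQ, hcritQ], fun hc => ?_⟩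
  have hcP : IsMCriticalPt (𝓡 3) Φ (P.lift u₀) := by rw [hcritP, hcritPQ]; exact hcritQ.1 hc
  have hcQ' : IsMCriticalPt (𝓡 3) B.g (Q.lift u₀) := by rw [hQlift]; exact hc
  obtain ⟨hndP, hidxP⟩ := P.morseData hu₀O hΦ2 hcP
  obtain ⟨hndQ, hidxQ⟩ := Q.morseData hu₀T (by rw [hQlift]; exact hgs.contMDiffAt.of_le (by norm_cast)) hcQ'
  rw [hQlift] at hndQ hidxQ
  have hhess : mhessian (𝓡 3) (Φ ∘ P.lift) u₀ = mhessian (𝓡 3) (B.g ∘ Q.lift) u₀ :=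
    mhessian_congr_of_eventuallyEq_add_const (I := 𝓡 3) hev
  have hidx : morseIndex (𝓡 3) (Φ ∘ P.lift) u₀ = morseIndex (𝓡 3) (B.g ∘ Q.lift) u₀ :=
    morseIndex_congr_of_eventuallyEq_add_const (I := 𝓡 3) hev
  exact ⟨by rw [hndP, hhess, ← hndQ], by rw [hidxP, hidx, ← hidxQ]⟩

end Transversal

end BiCollar

end Literature.Topology.FourManifolds

end
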